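import Summits.CriticalPhenomena.Ising3DConformalLimit.Theorems.EnergyNotSigmaSquaredGapForcesFarMergingScreeningDefsUnpin

/-!
# Objects of the line `screening-form-lemma-a1` for the crux `GapForcesFarMerging`, part 3:
# the annular (untilted) far end — currencies of the lead's reshape, seat a1
(item stmt-CriticalPhenomena-4468; route decl
`Summit.CriticalPhenomena.Ising3DConformalLimit.Theses.EnergyNotSigmaSquared.GapForcesFarMerging`;
lead seat a1 `prover-line-stmt-CriticalPhenomena-4468-a1-0`; parts 1–2 are
`Theorems/EnergyNotSigmaSquaredGapForcesFarMergingScreeningDefs.lean` and `…ScreeningDefsUnpin.lean`, whose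
vocabulary `screening`, `innerCluster`, `meanScreening`, `pinchScreen`, `FarScreeningIO`, `unpinShape`, `up`, `dn`, `e₂`
is used verbatim)

Route-posited objects (D-0016). The registered skeleton of seats gen-1/c2 closes the crux modulo
`Floors ∧ HazardRelocation ∧ Unpin`: a separation floor at every octave of the one-pinch screening ladder
`A(r;m) = pinchScreen n r m`, a RATIO-form relocation of the far ends at bounded aspect, and the un-tilting +
un-pinning of the probe at an opaque windowed octave. The reshape of seat a1 keeps the composition idea of the
line (RP un-pinch → screening ladder → an opaque step → un-pin → EXACT far end by Lemma A.1) but routes the far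
end through UNTILTED, ANNULAR screening quantities, so that no floor, no doubling window and no ratio-form
relocation is ever needed:

* `annPiece k o ω = C_{2^{k+1}}(o) ∖ Λ_{2^k}` — the part of the cluster explored inside `Λ_{2^{k+1}}` that lies in
  the annulus `Λ_{2^{k+1}} ∖ Λ_{2^k}` (at distance `≥ 2^k` from the pinch); `outerPiece n K o ω = C_n(o) ∖ Λ_{2^K}`;
* `annScreen n k o x a b = E^{ox,∅}_{Λ_n}[S_{ab}(annPiece k o)]`, `outerScreen n K o x a b = E^{ox,∅}_{Λ_n}[S_{ab}(outerPiece n K o)]`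
  — UNTILTED mean screenings `E[𝟙[b ∉ C]·S_{ab}(piece)]` of a probe pair `(a,b)` by those pieces (no screening tilt, no
  conditioning of the probe: the probe is independent of the cluster; by Griffiths antitonicity
  `meanScreening n n o x a b ≤ annScreen n k o x a b` for `a ∈ Λ_{2^k}`, so a drop of `annScreen` for a dilated probe pair IS
  far screening);
* the currencies of the five registered stubs of the reshaped skeleton:
  `OnePinchScreeningDecayDyadic` (the landed decay read along powers of two), `OpaqueStepIO` (ONE opaque step of
  the ladder beyond every octave — no floors: the product of the ratios is `≤ C M^{-κ'}/η(k₀)` by the root floor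
  at EVERY root octave), `AnnularDomination` (THE CORE: the tilted octave hazard is dominated by the untilted
  annular screening drop — a Harris-type inequality for the decreasing screening tilt against the decreasing
  annular avoidance of the duplicated sourced cluster), `NearSourceInsensitivity` (moving the probe source from
  the pinch `e₂` to a deep interior point `2^{k-j}u`, `j` free, changes the untilted annular screening by `≤ μ/2`:
  an additive re-rooting / interior-Harnack statement for ONE sourced current against far obstacles),
  `FarSourceInsensitivity` (moving both far ends between scales beyond aspect `2^A`, `A` free, changes it by
  `≤ μ/2`: the uniform-in-scale form of the sourced-IIC convergence).

None of the currencies is a literature fact; all are statements about the nearest-neighbour model's box laws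
`sourcedDoubleCurrentLaw 3 n β_c` and depleted box two-point functions only. References for the intended proofs:
Aizenman–Duminil-Copin 2021 (arXiv:1912.07973) §6.2, Thm 6.4 and (6.16) (mixing by re-rooting through a
mesoscopic sphere, `d = 4`, tree file `Literature/Probability/LatticeModels/RandomCurrentsMixingCore.lean`);
R. Panis, PTRF 194 (2025) Thm 2.4 / 3.1 (qualitative sourced mixing and the sourced IIC, `d ≥ 3`, tree named facts
`currentIIC_limit_exists`); T. E. Harris 1960 / Fortuin–Kasteleyn–Ginibre 1971 (the shape of `AnnularDomination`).
-/

noncomputable section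

namespace Summit.CriticalPhenomena.Ising3DConformalLimit.GapForcesFarMergingScreening

open scoped symmDiff ENNReal
open MeasureTheory Filter Finset
open Literature.Probability.LatticeModels Literature.Probability.Percolation
open Summit.CriticalPhenomena.Ising3DConformalLimit.Theorems.GapForcesFarMerging.Negative
  (e₁ e₂ cc2 xR up dn FarMergingShape SinglePinchLawShape)

/-! ### Annular and outer pieces of the explored cluster; untilted mean screenings -/

/-- The ANNULAR PIECE at octave `k` of the cluster of `o` explored inside `Λ_{2^{k+1}}`:
`C_{2^{k+1}}(o) ∖ Λ_{2^k}` (a subset of the annulus `Λ_{2^{k+1}} ∖ Λ_{2^k}`, at sup-distance `> 2^k` from `o = 0`). [folklore] -/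
def annPiece (k : ℕ) (o : Site 3) (ω : BondConfig (Site 3)) : Finset (Site 3) :=
  innerCluster (2 ^ (k + 1)) o ω \ box 3 (2 ^ k)

/-- The OUTER PIECE beyond radius `2^K` of the cluster of `o` explored in the whole box `Λ_n`: `C_n(o) ∖ Λ_{2^K}`. [folklore] -/
def outerPiece (n K : ℕ) (o : Site 3) (ω : BondConfig (Site 3)) : Finset (Site 3) :=
  innerCluster n o ω \ box 3 (2 ^ K)

open Classical in
/-- The annular screening functional `𝟙[b ∉ C(o)] · S⁽ⁿ⁾_{ab}(C_{2^{k+1}}(o) ∖ Λ_{2^k})`: the probe pair `(a,b)` tested against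
the annular piece only (the indicator of the FAR probe point keeps the functional honest when `b` is swallowed by the
cluster — then the probe is merged — and off the junk branch of the depleted two-point function; no indicator on the near
point `a`, which lies inside `Λ_{2^k}` in every use). [folklore] -/
def annWeight (n k : ℕ) (o a b : Site 3) (ω : BondConfig (Site 3)) : ℝ :=
  if b ∈ openCluster ω o then 0 else screening n (annPiece k o ω) a b

open Classical in
/-- The outer screening functional `𝟙[b ∉ C(o)] · S⁽ⁿ⁾_{ab}(C_n(o) ∖ Λ_{2^K})`. [folklore] -/
def outerWeight (n K : ℕ) (o a b : Site 3) (ω : BondConfig (Site 3)) : ℝ :=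
  if b ∈ openCluster ω o then 0 else screening n (outerPiece n K o ω) a b

/-- UNTILTED MEAN ANNULAR SCREENING `E^{ox,∅}_{Λ_n,β_c}[𝟙[b ∉ C]·S⁽ⁿ⁾_{ab}(C_{2^{k+1}}(o) ∖ Λ_{2^k})]` under the untilted
one-strand box law (a finite sum; no screening tilt, no conditioning of the probe). [folklore] -/
def annScreen (n k : ℕ) (o x a b : Site 3) : ℝ :=
  ∫ ω, annWeight n k o a b ω ∂(sourcedDoubleCurrentLaw 3 n (criticalBeta 3) ({o} ∆ {x}) ∅)

/-- UNTILTED MEAN OUTER SCREENING `E^{ox,∅}_{Λ_n,β_c}[𝟙[b ∉ C]·S⁽ⁿ⁾_{ab}(C_n(o) ∖ Λ_{2^K})]`. [folklore] -/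
def outerScreen (n K : ℕ) (o x a b : Site 3) : ℝ :=
  ∫ ω, outerWeight n K o a b ω ∂(sourcedDoubleCurrentLaw 3 n (criticalBeta 3) ({o} ∆ {x}) ∅)

/-! ### Currencies of the reshaped far end (statements of the registered stubs) -/

/-- (C2-dy) ONE-PINCH SCREENING DECAY ALONG POWERS OF TWO: for infinitely many `i`, eventually in the box size,
`A(n;2^i) ≤ C (2^i)^{-κ}`, `κ > 0` (the landed `OnePinchScreeningDecay`, whose decay scales are the axis-doubling scales
`m₀4^k`, re-run from a dyadic `m₀`). Conclusion of the registered stub `stub_decayDyadic` (route-posited currency). -/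
def OnePinchScreeningDecayDyadic : Prop :=
  ∃ κ C : ℝ, 0 < κ ∧ ∃ᶠ i : ℕ in atTop, ∀ᶠ n : ℕ in atTop,
    pinchScreen n n (2 ^ i) ≤ C * ((2 ^ i : ℕ) : ℝ) ^ (-κ)

/-- (C3′) ONE OPAQUE STEP BEYOND EVERY OCTAVE (no floors, no windows): there is `c > 0` such that for every `k₀` some
dyadic far scale `M = 2^{K+3}`, `K ≥ k₀`, carries either an OCTAVE step `k ∈ [k₀, K)` with
`0 < A(2^k;M)` and `A(2^{k+1};M) ≤ (1-c)·A(2^k;M)` frequently in `n`, or the BULK step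
`0 < A(2^K;M)` and `A(n;M) ≤ (1-c)·A(2^K;M)` frequently in `n`. (From the decay and the root floor at the root
octave `k₀`: the product of the `K - k₀ + 1` ratios is `≤ C M^{-κ}/η`; pigeonhole over the steps and over `n`.)
Conclusion of the registered stub `stub_opaqueStep` (route-posited currency, provable now). -/
def OpaqueStepIO : Prop :=
  ∃ c : ℝ, 0 < c ∧ ∀ k₀ : ℕ, ∃ K : ℕ, k₀ ≤ K ∧
    ((∃ k : ℕ, k₀ ≤ k ∧ k < K ∧ ∃ᶠ n : ℕ in atTop,
        0 < pinchScreen n (2 ^ k) (2 ^ (K + 3)) ∧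
          pinchScreen n (2 ^ (k + 1)) (2 ^ (K + 3)) ≤ (1 - c) * pinchScreen n (2 ^ k) (2 ^ (K + 3))) ∨
      ∃ᶠ n : ℕ in atTop,
        0 < pinchScreen n (2 ^ K) (2 ^ (K + 3)) ∧
          pinchScreen n n (2 ^ (K + 3)) ≤ (1 - c) * pinchScreen n (2 ^ K) (2 ^ (K + 3)))

/-- (C6-AD) ANNULAR DOMINATION (THE CORE of the reshaped transfer): for every drop `c > 0` there is `μ > 0` such that
(octave form) for all large octaves `k`, every `K > k` and all large `n`, an octave-`k` drop `≥ c` of the ladder with far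
ends at `M = 2^{K+3}` forces an UNTILTED annular screening drop `annScreen ≤ 1 - μ` of the pinned probe `(e₂, dn M)` by the
annular piece `C_{2^{k+1}}(0) ∖ Λ_{2^k}` of the strand `0 → up M`; (bulk form) for all large `K` and large `n`, a bulk drop
`A(n;M) ≤ (1-c)A(2^K;M)` forces `outerScreen n K ≤ 1 - μ`. Reading: the octave drop is the hazard of the probe under the
SCREENING TILT `𝟙[e₂,dn ∉ C]·S(C_{2^k})` (a decreasing functional of the cluster, of vanishing mean) — the tilted probability
that the depleted probe conditioned to avoid `C_{2^k}` is cut by `C_{2^{k+1}} ∖ C_{2^k}`; the conclusion is the untilted,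
unconditioned probability that a fresh probe is cut by the annular piece. The statement is a Harris/FKG-type domination
`E[W·h] ≤ (K·E[h̃] + ε)·E[W]` for the duplicated sourced cluster (no positive association is known for random currents; the
microscopic route-choice obstruction concerns two increasing visits of distinct regions, not this decreasing/decreasing pair).
Statement of the registered (open, hardest) stub `stub_annularDomination` (route-posited currency, not a literature fact). -/
def AnnularDomination : Prop :=
  ∀ c : ℝ, 0 < c → ∃ μ : ℝ, 0 < μ ∧
    (∀ᶠ k : ℕ in atTop, ∀ K : ℕ, k < K → ∀ᶠ n : ℕ in atTop,
      (0 < pinchScreen n (2 ^ k) (2 ^ (K + 3)) ∧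
        pinchScreen n (2 ^ (k + 1)) (2 ^ (K + 3)) ≤ (1 - c) * pinchScreen n (2 ^ k) (2 ^ (K + 3))) →
        annScreen n k 0 (up (2 ^ (K + 3))) e₂ (dn (2 ^ (K + 3))) ≤ 1 - μ) ∧
    (∀ᶠ K : ℕ in atTop, ∀ᶠ n : ℕ in atTop,
      (0 < pinchScreen n (2 ^ K) (2 ^ (K + 3)) ∧
        pinchScreen n n (2 ^ (K + 3)) ≤ (1 - c) * pinchScreen n (2 ^ K) (2 ^ (K + 3))) →
        outerScreen n K 0 (up (2 ^ (K + 3))) e₂ (dn (2 ^ (K + 3))) ≤ 1 - μ)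

/-- The deep interior probe source at octave `k`, granularity `j`: the lattice point `2^{k-j}·u`. [folklore] -/
def deepSource (k j : ℕ) (u : Site 3) : Site 3 := (((2 ^ (k - j) : ℕ) : ℤ)) • u

/-- (C6-NS) NEAR-SOURCE INSENSITIVITY WITH A FREE SCALE GAP: for every `μ > 0` there are a granularity `j` and a finite
nonempty family `F` of lattice points off the plane `{u₂ = 0}` (so that every shape `(0, up a, u, dn a)` is injective) such
that, for all large octaves `k`, every `K > k` and all large `n`: if the pinned probe `(e₂, dn M)`, `M = 2^{K+3}`, has
untilted annular screening `≤ 1 - μ` by the octave-`k` piece of the strand `0 → up M`, then for some `u ∈ F` the probe from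
the DEEP INTERIOR source `2^{k-j}u` to `dn M` has annular screening `≤ 1 - μ/2`; and likewise for the outer piece at a bulk
step `K` with the source `2^{K-j}u`. (The obstacle lies at sup-distance `≥ 2^k` from both sources, which are within
`2^{k-j}‖u‖` of each other: an ADDITIVE re-rooting / interior-Harnack statement for one sourced current and its depleted
vacuum against far deterministic obstacles — the cluster is independent of the probe, no tilt is involved.) Statement of
the registered (open) stub `stub_nearSource` (route-posited currency, not a literature fact). -/
def NearSourceInsensitivity : Prop :=
  ∀ μ : ℝ, 0 < μ → ∃ j : ℕ, ∃ F : Finset (Site 3), F.Nonempty ∧ (∀ u ∈ F, u 2 ≠ 0) ∧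
    (∀ᶠ k : ℕ in atTop, ∀ K : ℕ, k < K → ∀ᶠ n : ℕ in atTop,
      annScreen n k 0 (up (2 ^ (K + 3))) e₂ (dn (2 ^ (K + 3))) ≤ 1 - μ →
        ∃ u ∈ F, annScreen n k 0 (up (2 ^ (K + 3))) (deepSource k j u) (dn (2 ^ (K + 3))) ≤ 1 - μ / 2) ∧
    (∀ᶠ K : ℕ in atTop, ∀ᶠ n : ℕ in atTop,
      outerScreen n K 0 (up (2 ^ (K + 3))) e₂ (dn (2 ^ (K + 3))) ≤ 1 - μ →
        ∃ u ∈ F, outerScreen n K 0 (up (2 ^ (K + 3))) (deepSource K j u) (dn (2 ^ (K + 3))) ≤ 1 - μ / 2)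

/-- (C6-FS) FAR-SOURCE INSENSITIVITY, ADDITIVE, BOTH FAR SCALES BEYOND A FREE ASPECT: for every `μ > 0`, granularity `j`
and finite family `F` there is an aspect `A` such that for all large octaves `k`, every `K ≥ k + A`, all large `n` and every
`u ∈ F`: an annular screening `≤ 1 - μ` of the deep-source probe `(2^{k-j}u, dn 2^{K+3})` by the octave-`k` piece of the strand
`0 → up 2^{K+3}` forces an annular screening `≤ 1 - μ/2` of the probe `(2^{k-j}u, dn 2^{k+A+3})` by the octave-`k` piece of the
strand `0 → up 2^{k+A+3}` (both far scales at aspect `≥ 2^{A+2}` from the obstacle annulus; the uniform-in-`k` form of the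
sourced-IIC convergence of Panis 2025 Thm 3.1 for the strand, and of the far-end insensitivity of the probe's screening
ratio). Statement of the registered (open) stub `stub_farSource` (route-posited currency, not a literature fact). -/
def FarSourceInsensitivity : Prop :=
  ∀ μ : ℝ, 0 < μ → ∀ j : ℕ, ∀ F : Finset (Site 3), ∃ A : ℕ,
    ∀ᶠ k : ℕ in atTop, ∀ K : ℕ, k + A ≤ K → ∀ᶠ n : ℕ in atTop, ∀ u ∈ F,
      annScreen n k 0 (up (2 ^ (K + 3))) (deepSource k j u) (dn (2 ^ (K + 3))) ≤ 1 - μ →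
        annScreen n k 0 (up (2 ^ (k + A + 3))) (deepSource k j u) (dn (2 ^ (k + A + 3))) ≤ 1 - μ / 2

/-! ### Sanity lemmas (definitional / elementary) -/

/-- The annular piece is part of the cluster explored inside `Λ_{2^{k+1}}`. [folklore] -/
theorem annPiece_subset_innerCluster (k : ℕ) (o : Site 3) (ω : BondConfig (Site 3)) :
    annPiece k o ω ⊆ innerCluster (2 ^ (k + 1)) o ω :=
  sdiff_subset

/-- The annular piece avoids the inner box `Λ_{2^k}`. [folklore] -/
theorem annPiece_disjoint_box (k : ℕ) (o : Site 3) (ω : BondConfig (Site 3)) :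
    Disjoint (annPiece k o ω) (box 3 (2 ^ k)) :=
  sdiff_disjoint

/-- The outer piece is part of the cluster explored in the box. [folklore] -/
theorem outerPiece_subset_innerCluster (n K : ℕ) (o : Site 3) (ω : BondConfig (Site 3)) :
    outerPiece n K o ω ⊆ innerCluster n o ω :=
  sdiff_subset

/-- The deep source is the dilated lattice point `2^{k-j}•u` (definitional). [folklore] -/
theorem deepSource_eq (k j : ℕ) (u : Site 3) : deepSource k j u = (((2 ^ (k - j) : ℕ) : ℤ)) • u := rfl

/-- A point off the plane `{u₂ = 0}` gives an injective un-pinned shape `(0, up a, u, dn a)` for every `a ≥ 1`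
(`0`, `up a`, `dn a` lie in that plane and are pairwise distinct). [folklore] -/
theorem unpinShape_injective_of_ne : ∀ (u : Site 3), u 2 ≠ 0 → ∀ (a : ℕ), 1 ≤ a → Function.Injective (unpinShape a u) := by
  intro u hu a ha
  have hup1 : up a 1 = a := by simp [up, xR]
  have hdn1 : dn a 1 = -(a : ℤ) := by simp [dn, xR]
  have hup2 : up a 2 = 0 := by simp [up, xR]
  have hdn2 : dn a 2 = 0 := by simp [dn, xR]
  have ha' : (0 : ℤ) < a := by exact_mod_cast ha
  have h01 : (0 : Site 3) ≠ up a := fun h => by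
    have := congr_fun h 1; rw [hup1, Pi.zero_apply] at this; omega
  have h03 : (0 : Site 3) ≠ dn a := fun h => by
    have := congr_fun h 1; rw [hdn1, Pi.zero_apply] at this; omega
  have h13 : up a ≠ dn a := fun h => by
    have := congr_fun h 1; rw [hup1, hdn1] at this; omega
  have h02 : (0 : Site 3) ≠ u := fun h => hu (by rw [← h]; rfl)
  have h12 : up a ≠ u := fun h => hu (by rw [← h]; exact hup2)
  have h23 : u ≠ dn a := fun h => hu (by rw [h]; exact hdn2)
  rw [← List.nodup_ofFn]
  have hl : List.ofFn (unpinShape a u) = [0, up a, u, dn a] := by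
    simp [unpinShape, List.ofFn_succ]
  rw [hl]
  simp [h01, h02, h03, h12, h13, h23]

end Summit.CriticalPhenomena.Ising3DConformalLimit.GapForcesFarMergingScreening

end
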